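import Literature.NumberTheory.LFunctions.CertifiedLFunctionFourierTail
import Literature.NumberTheory.LFunctions.DirichletXiConjugation
import HarnessLib

/-!
# Platt's phase `ε_χ`: `Λ_χ(t)`, `F_e(t, χ)`, `F_o(t, χ)` are real for `ε_χ = e^{-iθ}`, `e^{2iθ} = ε(χ)`
# (Math. Comp. 85 (2016) §1 p. 3009, §7.2 p. 3019)

Topic `Literature/NumberTheory/LFunctions`; namespace `Literature.NumberTheory.LFunctions`, engine
sub-namespace `RealPhase`. Everything in this file is PROVED (no named fact, no new definition).
Typed for the parity-realchar cell (D-0088 (4) literature-typing layer, row «Platt 2016 (Math. Comp.,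
certified GRH/`L`-function computations)»): instrument provenance. Platt's method detects zeros of
`L_χ(1/2 + it)` as SIGN CHANGES of the completed function
`Λ_χ(t) := ε_χ (q/π)^{it/2} Γ((1/2 + a_χ + it)/2) exp(πt/4) L_χ(1/2 + it)` (p. 3009), which requires
«Given `ε_χ` such that `|ε_χ| = 1` … For suitably chosen `ε_χ`, `Λ_χ` is real valued and has the same
zeros as `L_χ(1/2 + it)`» (p. 3009); the same choice makes `F_e`, `F_o` of Algorithm 2 real («Now,
`F_e(x, χ)` is real valued», proof of Lemma 7.5, p. 3019). The paper does not spell the choice out; it is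
the classical one: `ε_χ = e^{-iθ}` with `e^{2iθ} = ε(χ)` the root number (Montgomery–Vaughan §10.1.1
Exercise 13, PROVED in the tree as `DirichletTheta.dirichletXi_criticalLine_mul_cexp_im_eq_zero`:
`ξ(1/2 + it, χ) e^{-iθ} ∈ ℝ`). This file records that choice against Platt's normalisations and
discharges the realness hypothesis of `platt2016_lemma75_even/odd`.

Source: D. J. Platt, *Numerical computations concerning the GRH*, Math. Comp. **85** (2016) 3009–3027
[Platt2016GRH], §1 p. 3009 (`Λ_χ`), §7 p. 3017 (`F_e`, `F_o`), §7.2 p. 3019 (proof of Lemma 7.5)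
(journal pdf, AMS open access; page-checked).

## Contents (all proved)

* `platt2016_completedL_real` — p. 3009 «for suitably chosen `ε_χ`, `Λ_χ` is real valued»: for `χ`
  primitive mod `q > 1`, `θ` real with `e^{2iθ} = ε(χ)` (Mathlib's `DirichletCharacter.rootNumber`),
  `Im(e^{-iθ} (q/π)^{it/2} Γ((1/2 + a_χ + it)/2) e^{πt/4} L_χ(1/2 + it)) = 0` for all real `t` (the `Λ_χ`
  of `CertifiedLFunctionWindowAliasingBound.lean` with `ε = e^{-iθ}`).
* `platt2016_F_real` — the same for `F(t, χ) = e^{-iθ} q^{it/2} π^{-(1/2+a_χ+it)/2} Γ((1/2+a_χ+it)/2) e^{πηt/4} L_χ(1/2+it)`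
  (`F_e`/`F_o` of p. 3017), any real `η`.
* `platt2016_lemma75_even_phase`, `platt2016_lemma75_odd_phase` — Lemma 7.5 (p. 3019) for
  `ε_χ = e^{-iθ}` WITHOUT the realness hypothesis (it is `platt2016_F_real`).
* Engine: `RealPhase.factor_eq_xi` —
  `q^{it/2} π^{-(1/2+a+it)/2} Γ((1/2+a+it)/2) L_χ(1/2+it) = q^{-(1/2+a)/2} ξ(1/2 + it, χ)` with the tree's
  `ξ(s, χ) = L(s, χ) Γ((s+κ)/2) (q/π)^{(s+κ)/2}` (`DirichletTheta.dirichletXi`, Montgomery–Vaughan (10.19)).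

## Method

`F(t, χ) = [e^{πηt/4} q^{-(1/2+a)/2}] · ξ(1/2 + it, χ) e^{-iθ}` and
`Λ_χ(t) = [e^{πt/4} π^{(1/2+a)/2} q^{-(1/2+a)/2}] · ξ(1/2 + it, χ) e^{-iθ}`, real multiples of the real
number `ξ(1/2 + it, χ) e^{-iθ}`; the bracket identities are bookkeeping of `cpow` with positive real
bases (principal logarithms `log q`, `log π`, `log(q/π) = log q - log π`).

`lean search` (2026-08-27): realness on the critical line is in the tree for `ξ` (above) and for Hardy's
`Z`; nothing for Platt's normalisation; nothing is restated.

## References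

* [Platt2016GRH] D. J. Platt, *Numerical computations concerning the GRH*, Math. Comp. 85 (2016),
  no. 302, 3009–3027, doi:10.1090/mcom/3077: §1 p. 3009, §7 p. 3017, §7.2 Lemma 7.5 p. 3019.
* H. L. Montgomery, R. C. Vaughan, *Multiplicative Number Theory I*, CUP 2007, §10.1.1 Exercise 13
  (the phase `e^{-iθ}`; tree `DirichletXiConjugation.lean`). [MontgomeryVaughan2007]
-/

noncomputable section

open Complex Filter Topology Set MeasureTheory DirichletCharacter
open scoped Real Nat

namespace Literature.NumberTheory.LFunctions

namespace RealPhase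

/-- **Platt's normalisation against `ξ`:** for `χ ≠ 1` mod `q > 1` and real `t`,
`q^{it/2} π^{-(1/2+a+it)/2} Γ((1/2+a+it)/2) L_χ(1/2+it) = q^{-(1/2+a)/2} ξ(1/2 + it, χ)`, `a = charParity χ`,
`ξ(s, χ) = L(s, χ)Γ((s+a)/2)(q/π)^{(s+a)/2}` the tree's `DirichletTheta.dirichletXi` (principal `cpow`s of the
positive reals `q`, `π`, `q/π`). [cite: Platt2016GRH, §7 p. 3017 (definition of F_e, F_o)] -/
theorem factor_eq_xi {q : ℕ} [NeZero q] (hq : 1 < q) {χ : DirichletCharacter ℂ q} (hχ1 : χ ≠ 1)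
    (t : ℝ) :
    (q : ℂ) ^ (I * t / 2) * (π : ℂ) ^ (-(1 / 2 + charParity χ + I * t) / 2) *
        Complex.Gamma ((1 / 2 + charParity χ + I * t) / 2) * χ.LFunction (1 / 2 + I * t) =
      (q : ℂ) ^ (-((1 / 2 + charParity χ) / 2) : ℂ) * DirichletTheta.dirichletXi χ (1 / 2 + t * I) := by
  set a : ℕ := charParity χ with ha
  have hs : ∀ n : ℕ, (1 / 2 + (t : ℂ) * I) + (charParity χ : ℂ) ≠ -(2 * (n : ℂ)) := by
    intro n h
    have := congrArg Complex.re h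
    simp at this
    have h0 : (0 : ℝ) ≤ charParity χ := Nat.cast_nonneg _
    have hn : (0 : ℝ) ≤ n := Nat.cast_nonneg _
    linarith
  rw [DirichletTheta.dirichletXi_eq_LFunction_mul hχ1 hs]
  have hq0 : (q : ℂ) ≠ 0 := by exact_mod_cast (show q ≠ 0 by omega)
  have hqpos : (0 : ℝ) < q := by exact_mod_cast (show 0 < q by omega)
  have hπ0 : (π : ℂ) ≠ 0 := by exact_mod_cast Real.pi_pos.ne'
  have hqπ : ((q : ℂ) / π) ≠ 0 := div_ne_zero hq0 hπ0
  have lq : Complex.log (q : ℂ) = ((Real.log q : ℝ) : ℂ) := by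
    rw [show (q : ℂ) = ((q : ℝ) : ℂ) by simp, ← Complex.ofReal_log hqpos.le]
  have lπ : Complex.log (π : ℂ) = ((Real.log π : ℝ) : ℂ) :=
    (Complex.ofReal_log Real.pi_pos.le).symm
  have lqπ : Complex.log ((q : ℂ) / π) = ((Real.log q - Real.log π : ℝ) : ℂ) := by
    rw [show (q : ℂ) / π = (((q : ℝ) / π : ℝ) : ℂ) by push_cast; ring,
      ← Complex.ofReal_log (div_pos hqpos Real.pi_pos).le, Real.log_div hqpos.ne' Real.pi_pos.ne']
  have e1 : (q : ℂ) ^ (I * t / 2) = Complex.exp (((Real.log q : ℝ) : ℂ) * (I * t / 2)) := by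
    rw [Complex.cpow_def_of_ne_zero hq0, lq]
  have e2 : (π : ℂ) ^ (-(1 / 2 + (a : ℂ) + I * t) / 2) =
      Complex.exp (((Real.log π : ℝ) : ℂ) * (-(1 / 2 + (a : ℂ) + I * t) / 2)) := by
    rw [Complex.cpow_def_of_ne_zero hπ0, lπ]
  have e3 : (q : ℂ) ^ (-((1 / 2 + (a : ℂ)) / 2) : ℂ) =
      Complex.exp (((Real.log q : ℝ) : ℂ) * (-((1 / 2 + (a : ℂ)) / 2))) := by
    rw [Complex.cpow_def_of_ne_zero hq0, lq]
  have e4 : ((q : ℂ) / π) ^ ((1 / 2 + t * I + (a : ℂ)) / 2) =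
      Complex.exp (((Real.log q - Real.log π : ℝ) : ℂ) * ((1 / 2 + t * I + (a : ℂ)) / 2)) := by
    rw [Complex.cpow_def_of_ne_zero hqπ, lqπ]
  have g_eq : Complex.Gamma ((1 / 2 + (a : ℂ) + I * t) / 2) =
      Complex.Gamma ((1 / 2 + t * I + (a : ℂ)) / 2) := by congr 1; ring
  have l_eq : χ.LFunction (1 / 2 + I * t) = χ.LFunction (1 / 2 + t * I) := by congr 1; ring
  rw [e1, e2, e3, e4, g_eq, l_eq]
  have key : Complex.exp (((Real.log q : ℝ) : ℂ) * (I * t / 2)) *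
      Complex.exp (((Real.log π : ℝ) : ℂ) * (-(1 / 2 + (a : ℂ) + I * t) / 2)) =
      Complex.exp (((Real.log q : ℝ) : ℂ) * (-((1 / 2 + (a : ℂ)) / 2))) *
        Complex.exp (((Real.log q - Real.log π : ℝ) : ℂ) * ((1 / 2 + t * I + (a : ℂ)) / 2)) := by
    rw [← Complex.exp_add, ← Complex.exp_add]
    congr 1
    push_cast
    ring
  linear_combination (Complex.Gamma ((1 / 2 + t * I + (a : ℂ)) / 2) * χ.LFunction (1 / 2 + t * I)) * key

end RealPhase

open RealPhase

/-- **Platt's `F_e`, `F_o` are real for `ε_χ = e^{-iθ}`** («Now, `F_e(x, χ)` is real valued», proof of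
Lemma 7.5, p. 3019): for `χ` primitive mod `q > 1`, `θ ∈ ℝ` with `e^{2iθ} = ε(χ)`
(`DirichletCharacter.rootNumber`), any real `η`, `t`,
`Im(e^{-iθ} q^{it/2} π^{-(1/2+a_χ+it)/2} Γ((1/2+a_χ+it)/2) e^{πηt/4} L_χ(1/2+it)) = 0` — `F_e` (`a_χ = 0`) and
`F_o` (`a_χ = 1`) of p. 3017 with `ε_χ = e^{-iθ}`. From `RealPhase.factor_eq_xi` and the tree's
`DirichletTheta.dirichletXi_criticalLine_mul_cexp_im_eq_zero` (`ξ(1/2+it, χ)e^{-iθ} ∈ ℝ`,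
Montgomery–Vaughan Ex. 10.1.13). [cite: Platt2016GRH, §7.2 p. 3019 (proof of Lemma 7.5)] -/
theorem platt2016_F_real {q : ℕ} [NeZero q] (hq : 1 < q) {χ : DirichletCharacter ℂ q}
    (hχ : χ.IsPrimitive) {θ : ℝ} (hθ : Complex.exp (2 * θ * I) = rootNumber χ) (η t : ℝ) :
    (Complex.exp (-(θ * I)) * (q : ℂ) ^ (I * t / 2) *
        (π : ℂ) ^ (-(1 / 2 + charParity χ + I * t) / 2) *
        Complex.Gamma ((1 / 2 + charParity χ + I * t) / 2) * Complex.exp (π * η * t / 4) *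
        χ.LFunction (1 / 2 + I * t)).im = 0 := by
  have hq1 : q ≠ 1 := by omega
  have hχ1 : χ ≠ 1 := SelbergDirichlet.ne_one_of_isPrimitive hq1 hχ
  have hxi := DirichletTheta.dirichletXi_criticalLine_mul_cexp_im_eq_zero hχ hχ1 hθ t
  have hqpos : (0 : ℝ) ≤ q := Nat.cast_nonneg q
  have hfac := factor_eq_xi hq hχ1 t
  -- rearrange into `(real) * (ξ e^{-iθ})`
  have hr : Complex.exp (-(θ * I)) * (q : ℂ) ^ (I * t / 2) *
        (π : ℂ) ^ (-(1 / 2 + charParity χ + I * t) / 2) *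
        Complex.Gamma ((1 / 2 + charParity χ + I * t) / 2) * Complex.exp (π * η * t / 4) *
        χ.LFunction (1 / 2 + I * t) =
      ((Real.exp (π * η * t / 4) * (q : ℝ) ^ (-((1 / 2 + (charParity χ : ℝ)) / 2)) : ℝ) : ℂ) *
        (DirichletTheta.dirichletXi χ (1 / 2 + t * I) * Complex.exp (-(θ * I))) := by
    have : Complex.exp (-(θ * I)) * (q : ℂ) ^ (I * t / 2) *
        (π : ℂ) ^ (-(1 / 2 + charParity χ + I * t) / 2) *
        Complex.Gamma ((1 / 2 + charParity χ + I * t) / 2) * Complex.exp (π * η * t / 4) *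
        χ.LFunction (1 / 2 + I * t) =
        Complex.exp (-(θ * I)) * Complex.exp (π * η * t / 4) *
          ((q : ℂ) ^ (I * t / 2) * (π : ℂ) ^ (-(1 / 2 + charParity χ + I * t) / 2) *
            Complex.Gamma ((1 / 2 + charParity χ + I * t) / 2) * χ.LFunction (1 / 2 + I * t)) := by
      ring
    rw [this, hfac, Complex.ofReal_mul, Complex.ofReal_exp, Complex.ofReal_cpow hqpos]
    push_cast
    ring
  rw [hr, Complex.im_ofReal_mul, hxi, mul_zero]

/-- **Platt 2016, p. 3009: «For suitably chosen `ε_χ`, `Λ_χ` is real valued»**, with the choice made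
explicit: for `χ` primitive mod `q > 1` and `θ ∈ ℝ` with `e^{2iθ} = ε(χ)`,
`Im(e^{-iθ} (q/π)^{it/2} Γ((1/2 + a_χ + it)/2) exp(πt/4) L_χ(1/2 + it)) = 0` for all real `t` — Platt's
`Λ_χ(t) = ε_χ (q/π)^{it/2} Γ((1/2+a_χ+it)/2) exp(πt/4) L_χ(1/2+it)` (as written out in
`platt2016_lemma85`) with `ε_χ = e^{-iθ}`, `|ε_χ| = 1`. (Sign changes of this real function are what
the verification counts, §2.) [cite: Platt2016GRH, §1 p. 3009] -/
theorem platt2016_completedL_real {q : ℕ} [NeZero q] (hq : 1 < q) {χ : DirichletCharacter ℂ q}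
    (hχ : χ.IsPrimitive) {θ : ℝ} (hθ : Complex.exp (2 * θ * I) = rootNumber χ) (t : ℝ) :
    (Complex.exp (-(θ * I)) * ((q : ℂ) / π) ^ (I * t / 2) *
        Complex.Gamma ((1 / 2 + charParity χ + I * t) / 2) * Complex.exp (π * t / 4) *
        χ.LFunction (1 / 2 + I * t)).im = 0 := by
  have h := platt2016_F_real hq hχ hθ 1 t
  have hq0 : (q : ℂ) ≠ 0 := by exact_mod_cast (show q ≠ 0 by omega)
  have hqpos : (0 : ℝ) < q := by exact_mod_cast (show 0 < q by omega)
  have hπ0 : (π : ℂ) ≠ 0 := by exact_mod_cast Real.pi_pos.ne'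
  -- `(q/π)^{it/2} = q^{it/2} π^{-(1/2+a+it)/2} · π^{(1/2+a)/2}`
  have lq : Complex.log (q : ℂ) = ((Real.log q : ℝ) : ℂ) := by
    rw [show (q : ℂ) = ((q : ℝ) : ℂ) by simp, ← Complex.ofReal_log hqpos.le]
  have lπ : Complex.log (π : ℂ) = ((Real.log π : ℝ) : ℂ) :=
    (Complex.ofReal_log Real.pi_pos.le).symm
  have lqπ : Complex.log ((q : ℂ) / π) = ((Real.log q - Real.log π : ℝ) : ℂ) := by
    rw [show (q : ℂ) / π = (((q : ℝ) / π : ℝ) : ℂ) by push_cast; ring,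
      ← Complex.ofReal_log (div_pos hqpos Real.pi_pos).le, Real.log_div hqpos.ne' Real.pi_pos.ne']
  have key : ((q : ℂ) / π) ^ (I * t / 2) =
      (((π ^ ((1 / 2 + (charParity χ : ℝ)) / 2) : ℝ) : ℂ)) *
        ((q : ℂ) ^ (I * t / 2) * (π : ℂ) ^ (-(1 / 2 + charParity χ + I * t) / 2)) := by
    rw [Complex.cpow_def_of_ne_zero (div_ne_zero hq0 hπ0), lqπ, Complex.cpow_def_of_ne_zero hq0, lq,
      Complex.cpow_def_of_ne_zero hπ0, lπ, Complex.ofReal_cpow Real.pi_pos.le,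
      Complex.cpow_def_of_ne_zero hπ0, lπ, ← Complex.exp_add, ← Complex.exp_add]
    congr 1
    push_cast
    ring
  have hr : Complex.exp (-(θ * I)) * ((q : ℂ) / π) ^ (I * t / 2) *
        Complex.Gamma ((1 / 2 + charParity χ + I * t) / 2) * Complex.exp (π * t / 4) *
        χ.LFunction (1 / 2 + I * t) =
      (((π ^ ((1 / 2 + (charParity χ : ℝ)) / 2) : ℝ) : ℂ)) *
        (Complex.exp (-(θ * I)) * (q : ℂ) ^ (I * t / 2) *
          (π : ℂ) ^ (-(1 / 2 + charParity χ + I * t) / 2) *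
          Complex.Gamma ((1 / 2 + charParity χ + I * t) / 2) * Complex.exp (π * (1 : ℝ) * t / 4) *
          χ.LFunction (1 / 2 + I * t)) := by
    rw [key]; push_cast; ring
  rw [hr, Complex.im_ofReal_mul, h, mul_zero]

/-- **Platt 2016, Lemma 7.5, even case, for Platt's `ε_χ = e^{-iθ}` (`e^{2iθ} = ε(χ)`)** — the statement
of `platt2016_lemma75_even` with its realness hypothesis discharged by `platt2016_F_real`:
`|F̃̂_e(n, χ) - F̂_e(2πn/B, χ)| ≤ 4 (e^{w₁/2 - X(w₁)}(1 + 1/(2X(w₁))) + e^{w₂/2 - X(w₂)}(1 + 1/(2X(w₂)))) / (q^{1/4} δ^{1/2} (1 - e^{-πA}))`.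
[cite: Platt2016GRH, Lemma 7.5 p. 3019] -/
theorem platt2016_lemma75_even_phase {q : ℕ} [NeZero q] (hq : 1 < q) {χ : DirichletCharacter ℂ q}
    (hχ : χ.IsPrimitive) (hχe : χ.Even) {θ : ℝ} (hθ : Complex.exp (2 * θ * I) = rootNumber χ)
    {η : ℝ} (hη : |η| < 1) (Fhat : ℝ → ℂ)
    (hFhat : ∀ y : ℝ, Fhat y = 1 / (2 * π) * ∫ t : ℝ, Complex.exp (-(θ * I)) * (q : ℂ) ^ (I * t / 2) *
        (π : ℂ) ^ (-(1 / 2 + I * t) / 2) * Complex.Gamma ((1 / 2 + I * t) / 2) *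
        Complex.exp (π * η * t / 4) * χ.LFunction (1 / 2 + I * t) * Complex.exp (-I * y * t))
    {A : ℝ} (hA : 0 < A) (B : ℝ) (n : ℤ) {δ : ℝ} (hδ : δ = π / 2 * (1 - |η|))
    {w₁ w₂ X₁ X₂ : ℝ} (hw₁ : w₁ = 2 * π * n / B + 2 * π * A) (hw₂ : w₂ = -(2 * π * n / B) + 2 * π * A)
    (hX₁ : X₁ = π * δ * Real.exp (2 * w₁ - δ) / q) (hX₂ : X₂ = π * δ * Real.exp (2 * w₂ - δ) / q)
    (hX₁1 : 1 < X₁) (hX₂1 : 1 < X₂) :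
    ‖(∑' k : ℤ, Fhat (2 * π * n / B + 2 * π * k * A)) - Fhat (2 * π * n / B)‖ ≤
      4 * (Real.exp (w₁ / 2 - X₁) * (1 + 1 / (2 * X₁)) + Real.exp (w₂ / 2 - X₂) * (1 + 1 / (2 * X₂))) /
        ((q : ℝ) ^ (1 / 4 : ℝ) * Real.sqrt δ * (1 - Real.exp (-(π * A)))) := by
  have hreal : ∀ t : ℝ, (Complex.exp (-(θ * I)) * (q : ℂ) ^ (I * t / 2) *
        (π : ℂ) ^ (-(1 / 2 + I * t) / 2) * Complex.Gamma ((1 / 2 + I * t) / 2) *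
        Complex.exp (π * η * t / 4) * χ.LFunction (1 / 2 + I * t)).im = 0 := by
    intro t
    have h := platt2016_F_real hq hχ hθ η t
    rw [charParity_of_even hχe] at h
    simpa only [Nat.cast_zero, add_zero] using h
  have hε : ‖Complex.exp (-(θ * I))‖ = 1 := by rw [Complex.norm_exp]; simp
  exact platt2016_lemma75_even hq hχ hχe hε hη hreal Fhat hFhat hA B n hδ hw₁ hw₂ hX₁ hX₂ hX₁1 hX₂1

/-- **Platt 2016, Lemma 7.5, odd case, for Platt's `ε_χ = e^{-iθ}`** — `platt2016_lemma75_odd` with its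
realness hypothesis discharged by `platt2016_F_real`. [cite: Platt2016GRH, Lemma 7.5 p. 3019] -/
theorem platt2016_lemma75_odd_phase {q : ℕ} [NeZero q] (hq : 1 < q) {χ : DirichletCharacter ℂ q}
    (hχ : χ.IsPrimitive) (hχo : χ.Odd) {θ : ℝ} (hθ : Complex.exp (2 * θ * I) = rootNumber χ)
    {η : ℝ} (hη : |η| < 1) (Fhat : ℝ → ℂ)
    (hFhat : ∀ y : ℝ, Fhat y = 1 / (2 * π) * ∫ t : ℝ, Complex.exp (-(θ * I)) * (q : ℂ) ^ (I * t / 2) *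
        (π : ℂ) ^ (-(3 / 2 + I * t) / 2) * Complex.Gamma ((3 / 2 + I * t) / 2) *
        Complex.exp (π * η * t / 4) * χ.LFunction (1 / 2 + I * t) * Complex.exp (-I * y * t))
    {A : ℝ} (hA : 0 < A) (B : ℝ) (n : ℤ) {δ : ℝ} (hδ : δ = π / 2 * (1 - |η|))
    {w₁ w₂ X₁ X₂ : ℝ} (hw₁ : w₁ = 2 * π * n / B + 2 * π * A) (hw₂ : w₂ = -(2 * π * n / B) + 2 * π * A)
    (hX₁ : X₁ = π * δ * Real.exp (2 * w₁ - δ) / q) (hX₂ : X₂ = π * δ * Real.exp (2 * w₂ - δ) / q)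
    (hX₁1 : 1 < X₁) (hX₂1 : 1 < X₂) :
    ‖(∑' k : ℤ, Fhat (2 * π * n / B + 2 * π * k * A)) - Fhat (2 * π * n / B)‖ ≤
      4 * (Real.exp (3 * w₁ / 2 - X₁) * (1 + 1 / (2 * X₁)) ^ (3 / 2 : ℝ) +
          Real.exp (3 * w₂ / 2 - X₂) * (1 + 1 / (2 * X₂)) ^ (3 / 2 : ℝ)) /
        ((q : ℝ) ^ (3 / 4 : ℝ) * Real.sqrt δ * (1 - Real.exp (-(π * A)))) := by
  have hreal : ∀ t : ℝ, (Complex.exp (-(θ * I)) * (q : ℂ) ^ (I * t / 2) *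
        (π : ℂ) ^ (-(3 / 2 + I * t) / 2) * Complex.Gamma ((3 / 2 + I * t) / 2) *
        Complex.exp (π * η * t / 4) * χ.LFunction (1 / 2 + I * t)).im = 0 := by
    intro t
    have h := platt2016_F_real hq hχ hθ η t
    rw [charParity_of_odd hχo] at h
    have e0 : (1 / 2 : ℂ) + 1 = 3 / 2 := by norm_num
    simpa only [Nat.cast_one, e0] using h
  have hε : ‖Complex.exp (-(θ * I))‖ = 1 := by rw [Complex.norm_exp]; simp
  exact platt2016_lemma75_odd hq hχ hχo hε hη hreal Fhat hFhat hA B n hδ hw₁ hw₂ hX₁ hX₂ hX₁1 hX₂1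

end Literature.NumberTheory.LFunctions

end
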